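import Summits.HodgeConjecture.HodgeConjecture.Theorems.Ring2WeilCoverageCMFieldAllPrimesU
import Summits.HodgeConjecture.HodgeConjecture.Theorems.Ring2WeilCoverageCMFieldAllPrimesO
import HarnessLib

/-!
# Weil-type components over quartic CM fields, IX (part V): the SPLIT side of the seventh census table with
# `ℓ` variable — and the complete classification of `[ℓ]` for every prime, `E = ℚ(√-(3+√2))`

research route conditional on HC_CM; not a corollary; Q11.4-sentence-2 already refuted in dim ≥ 3. Cell
`pub-hodge-ring2`, seat `ring2-b03` (gen 53); `HOME/WEIL-FAMILY-COVERAGE.md` §b03.5, seventh table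
(`E = F(η)`, `η² = σ = -3-√2`, `F = ℚ(√2)`, `R = S² + 6S + 7`; the non-Galois `D₄` field, `h(E) = 2`). Parts P–U
give, for every prime element of `ℤ[σ] = ℤ[√2]` split in `E`, its class in `F^×/Nm_{E/F}(E^×)`: `[π] = [1]` or
`[3π] = [1]` according to the quadratic character of `π` at the tame ramified place `(σ)` (norm `7`). For a
rational prime `ℓ` this yields, with `ℓ` VARIABLE:

* §1 `ℓ ≡ ±3 (mod 8)` (inert in `F`) with `(7/ℓ) = +1` (so `(ℓ)` splits in `E/F`): **`[ℓ] = [1]` if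
  `ℓ ≡ 1, 2, 4 (mod 7)`** (these are `ℓ ≡ 5 (mod 8)`), `[3ℓ] = [1]` if `ℓ ≡ 3, 5, 6 (mod 7)` (these are
  `ℓ ≡ 3 (mod 8)`);
* §2 `ℓ ≡ ±1 (mod 8)`, `(7/ℓ) = +1`, `T⁴ + 6T² + 7` with a root mod `ℓ` (both places of `F` over `ℓ` split in `E`):
  `ℓ = θθ̄` and **`[ℓ] = [θ][θ̄] = [1]` if `ℓ ≡ 1, 2, 4 (mod 7)`**, `[3ℓ] = [1]` otherwise;
* §3 with part O (the necessary half) the **complete classification, every prime `ℓ`: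
  `[ℓ] = [1] ⟺ ℓ = 2 ∨ (ℓ ≡ 5 (8) ∧ ℓ ≡ 1,2,4 (7)) ∨ (ℓ ≡ 1 (8) ∧ ℓ ≡ 1,2,4 (7) ∧ ∃ e, e⁴ + 6e² + 7 ≡ 0 (ℓ))`**
  — the seventh and last census field has the split/non-split type of `W8.E.[ℓ]` decided for every rational
  prime (the third condition is a Frobenius condition in the `D₄`-closure, not a congruence); literal packaging.

No named fact, no definition, no `sorry`; nothing about the Hodge conjecture is asserted.
References: [Deligne1982HodgeCycles] §4 p. 30 (1), Cor. 4.2; [Landherr1936HermitianForms]. -/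

noncomputable section

set_option linter.dupNamespace false

open Polynomial

namespace Summit.HodgeConjecture.HodgeConjecture.Ring2.WeilCoverageCM

open Literature.AlgebraicGeometry.Deligne1982
open Literature.AlgebraicGeometry.HodgeTheory (splitDiscriminantClassCM)

section SqrtNegThreePlusSqrtTwo

variable {R : Polynomial ℤ} (hR : R = X ^ 2 + C 6 * X + C 7) [Fact (Irreducible (realPolyQ R))]
include hR

/-! ### §1 Inert rational primes split in `E/F` -/

/-- **Classes of an inert rational prime split in `E/F`.** `ℓ` prime, `2` a non-square and `7` a square mod `ℓ`
(`ℓ ≡ ±3 (mod 8)`, `(7/ℓ) = 1`): `[ℓ] = [1]` if `ℓ` is a square mod `7`, and `[3ℓ] = [1]` if not (part T's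
witness for `(ℓ, 0)`, part U's `class_of_witness`). [cite: Deligne1982HodgeCycles, §4 p. 30 (1) and Cor. 4.2]
[cite: Landherr1936HermitianForms] -/
theorem sqrtNegThreePlusSqrtTwo_class_inert_prime (ℓ : ℕ) (hℓ : ℓ.Prime) (h2 : ¬ IsSquare (2 : ZMod ℓ))
    (h7 : IsSquare (7 : ZMod ℓ)) :
    (IsSquare ((ℓ : ZMod 7)) → ∀ w : (realField R)ˣ, (w : realField R) = ℓ →
        (QuotientGroup.mk w : cmNormResidueGroup R) = splitDiscriminantClassCM R 2) ∧
    (¬ IsSquare ((ℓ : ZMod 7)) → ∀ w : (realField R)ˣ, (w : realField R) = 3 * ℓ →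
        (QuotientGroup.mk w : cmNormResidueGroup R) = splitDiscriminantClassCM R 2) := by
  have hsq27 : IsSquare (2 : ZMod 7) := by decide
  have hℓ2 : ℓ ≠ 2 := by rintro rfl; exact h2 ⟨0, by decide⟩
  have hℓ7 : ℓ ≠ 7 := by rintro rfl; exact h2 hsq27
  have h7u : ¬ (7 : ℤ) ∣ (ℓ : ℤ) := by
    intro h
    have h' : 7 ∣ ℓ := by exact_mod_cast h
    rcases (Nat.dvd_prime hℓ).1 h' with h1 | h1
    · norm_num at h1
    · exact hℓ7 h1.symm
  obtain ⟨a₀, a₁, b₀, b₁, m₀, m₁, e, hX, hY, hpos, hN⟩ :=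
    (splitType_witness (ℓ ^ 2)).2 ℓ hℓ hℓ2 le_rfl h2 h7
  have hC := class_of_witness hR (ℓ : ℤ) 0 h7u a₀ a₁ b₀ b₁ m₀ m₁ e hX hY hpos hN
  have hcoe : AdjoinRoot.of (realPolyQ R) ((ℓ : ℤ) : ℚ) + AdjoinRoot.of (realPolyQ R) ((0 : ℤ) : ℚ) *
      AdjoinRoot.root (realPolyQ R) = (ℓ : realField R) := by
    simp only [Int.cast_natCast, Int.cast_zero, map_natCast, map_zero, zero_mul, add_zero]
  push_cast at hC
  refine ⟨fun hsq w hw => hC.1 hsq w (by rw [hw, ← hcoe]; push_cast; ring),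
    fun hns w hw => hC.2 hns w (by rw [hw, ← hcoe]; push_cast; ring)⟩

/-- **`[ℓ] = [1]` for EVERY prime `ℓ ≡ 5 (mod 8)` with `ℓ ≡ 1, 2, 4 (mod 7)`** (`E = ℚ(√-(3+√2))`; the second
split type of part O: `ℓ` inert in `F`, `(7/ℓ) = (ℓ/7) = 1`): census rows `[29] = [37] = [53] = [109] = … = [1]`
with `ℓ` variable. [cite: Deligne1982HodgeCycles, §4 p. 30 (1) and Cor. 4.2] [cite: Landherr1936HermitianForms] -/
theorem sqrtNegThreePlusSqrtTwo_mk_prime_eq_splitDiscriminantClassCM_of_mod_eight_five (ℓ : ℕ) (hℓ : ℓ.Prime)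
    (h8 : ℓ % 8 = 5) (h7 : ℓ % 7 = 1 ∨ ℓ % 7 = 2 ∨ ℓ % 7 = 4)
    (u : (realField R)ˣ) (hu : (u : realField R) = ℓ) :
    (QuotientGroup.mk u : cmNormResidueGroup R) = splitDiscriminantClassCM R 2 := by
  -- decidable residue facts first
  have hsq7 : IsSquare ((ℓ : ZMod 7)) := by
    rw [← ZMod.natCast_mod ℓ 7]
    rcases h7 with h | h | h <;> rw [h] <;> decide
  haveI : Fact ℓ.Prime := ⟨hℓ⟩
  have hℓ2 : ℓ ≠ 2 := by omega
  have h2 : ¬ IsSquare (2 : ZMod ℓ) := by rw [ZMod.exists_sq_eq_two_iff hℓ2]; omega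
  have h7sq : IsSquare (7 : ZMod ℓ) := by
    haveI : Fact (Nat.Prime 7) := ⟨by norm_num⟩
    have := (ZMod.exists_sq_eq_prime_iff_of_mod_four_eq_one (p := ℓ) (q := 7) (by omega) (by norm_num)).2
      (by exact_mod_cast hsq7)
    exact_mod_cast this
  exact (sqrtNegThreePlusSqrtTwo_class_inert_prime hR ℓ hℓ h2 h7sq).1 hsq7 u hu

/-- **`[3ℓ] = [1]` (so `[ℓ] = [3] ≠ [1]`) for every prime `ℓ ≡ 3 (mod 8)` with `ℓ ≡ 3, 5, 6 (mod 7)`**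
(`(7/ℓ) = -(ℓ/7) = +1`: `(ℓ)` splits in `E/F`, but `ℓ` is a non-square at `(σ)`; rows `[3] = [19] = [59] = …`,
all equal to `[3]`). [cite: Deligne1982HodgeCycles, §4 p. 30 (1) and Cor. 4.2] [cite: Landherr1936HermitianForms] -/
theorem sqrtNegThreePlusSqrtTwo_mk_three_mul_prime_eq_splitDiscriminantClassCM_of_mod_eight_three (ℓ : ℕ)
    (hℓ : ℓ.Prime) (h8 : ℓ % 8 = 3) (h7 : ℓ % 7 = 3 ∨ ℓ % 7 = 5 ∨ ℓ % 7 = 6)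
    (u : (realField R)ˣ) (hu : (u : realField R) = 3 * ℓ) :
    (QuotientGroup.mk u : cmNormResidueGroup R) = splitDiscriminantClassCM R 2 := by
  have hns7 : ¬ IsSquare ((ℓ : ZMod 7)) := by
    rw [← ZMod.natCast_mod ℓ 7]
    rcases h7 with h | h | h <;> rw [h] <;> decide
  haveI : Fact ℓ.Prime := ⟨hℓ⟩
  have hℓ2 : ℓ ≠ 2 := by omega
  have hℓ7 : ℓ ≠ 7 := by omega
  have h2 : ¬ IsSquare (2 : ZMod ℓ) := by rw [ZMod.exists_sq_eq_two_iff hℓ2]; omega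
  have h7sq : IsSquare (7 : ZMod ℓ) := by
    haveI : Fact (Nat.Prime 7) := ⟨by norm_num⟩
    by_contra h
    have key := ZMod.exists_sq_eq_prime_iff_of_mod_four_eq_three (p := ℓ) (q := 7) (by omega) (by norm_num) hℓ7
    have : IsSquare ((ℓ : ℕ) : ZMod 7) := by
      by_contra h'
      exact h (by exact_mod_cast key.2 h')
    exact hns7 this
  exact (sqrtNegThreePlusSqrtTwo_class_inert_prime hR ℓ hℓ h2 h7sq).2 hns7 u hu

/-! ### §2 Primes split in `F` with both places split in `E` -/

/-- **Classes of a prime `ℓ ≠ 2, 7` with `2` and `7` squares mod `ℓ` and a root of `T⁴ + 6T² + 7`** (both places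
of `F = ℚ(√2)` over `ℓ` split in `E`): with a Thue generator `θ` (part R) and its conjugate, `ℓ = θθ̄`, both
split-type (`-t ∈ {e₀², 7/e₀²}`), classes by part U; `[ℓ] = [1]` if `ℓ` is a square mod `7`, `[3ℓ] = [1]` if not
(`u₀(u₀ - 6v₀) ≡ ℓ (mod 7)` couples the two characters). [cite: Deligne1982HodgeCycles, §4 p. 30 (1) and Cor. 4.2]
[cite: Landherr1936HermitianForms] -/
theorem sqrtNegThreePlusSqrtTwo_class_split_prime (ℓ : ℕ) (hℓ : ℓ.Prime) (hℓ2 : ℓ ≠ 2) (hℓ7 : ℓ ≠ 7)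
    (h2 : IsSquare (2 : ZMod ℓ)) (h7 : IsSquare (7 : ZMod ℓ)) (hroot : ∃ e₀ : ZMod ℓ, e₀ ^ 4 + 6 * e₀ ^ 2 + 7 = 0) :
    (IsSquare ((ℓ : ZMod 7)) → ∀ w : (realField R)ˣ, (w : realField R) = ℓ →
        (QuotientGroup.mk w : cmNormResidueGroup R) = splitDiscriminantClassCM R 2) ∧
    (¬ IsSquare ((ℓ : ZMod 7)) → ∀ w : (realField R)ˣ, (w : realField R) = 3 * ℓ →
        (QuotientGroup.mk w : cmNormResidueGroup R) = splitDiscriminantClassCM R 2) := by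
  have h70 : (7 : ZMod 7) = 0 := by decide
  haveI : Fact ℓ.Prime := ⟨hℓ⟩
  haveI : Fact (Irreducible (cmPolyQ R)) := fact_irreducible_cmPolyQ_of_pos hR (by norm_num) (by norm_num) disc_not_sq_six_seven
  have hℓ0 : (0 : ℤ) < ℓ := by exact_mod_cast hℓ.pos
  obtain ⟨u₀, v₀, g₀, g₁, t, hN, ht, hγ, hpos⟩ := exists_degOne_gen hℓ h2
  -- the conjugate generator
  have hN' : (u₀ - 6 * v₀) ^ 2 - 6 * (u₀ - 6 * v₀) * (-v₀) + 7 * (-v₀) ^ 2 = ℓ := by linear_combination hN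
  have ht' : (u₀ - 6 * v₀) * (6 * g₁ - g₀) - 7 * (-v₀) * g₁ = 6 - t := by rw [← ht]; linear_combination 6 * hγ
  have hγ' : (-v₀) * (6 * g₁ - g₀) + (u₀ - 6 * v₀) * g₁ - 6 * (-v₀) * g₁ = 1 := by linear_combination hγ
  have hpos' : 0 < (u₀ - 6 * v₀) - 3 * (-v₀) := by linarith
  -- `7 ∤ u₀`, `7 ∤ u₀ - 6v₀`
  have h7ℓ : ¬ (7 : ℤ) ∣ (ℓ : ℤ) := by
    intro h
    have h' : 7 ∣ ℓ := by exact_mod_cast h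
    rcases (Nat.dvd_prime hℓ).1 h' with h1 | h1
    · norm_num at h1
    · exact hℓ7 h1.symm
  have h7u : ¬ (7 : ℤ) ∣ u₀ := by
    rintro ⟨k, hk⟩
    exact h7ℓ ⟨7 * k ^ 2 - 6 * k * v₀ + v₀ ^ 2, by rw [← hN, hk]; ring⟩
  have h7u' : ¬ (7 : ℤ) ∣ u₀ - 6 * v₀ := by
    rintro ⟨k, hk⟩
    exact h7ℓ ⟨7 * k ^ 2 + 6 * k * v₀ + v₀ ^ 2, by rw [← hN', hk]; ring⟩
  -- both `-t` and `-(6 - t)` are squares mod `ℓ`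
  have hrt := degOne_root hN ht hγ
  obtain ⟨e₀, he₀⟩ := hroot
  obtain ⟨c, hc⟩ := h7
  have h7ne : (7 : ZMod ℓ) ≠ 0 := by exact_mod_cast natCast_prime_ne_zero_zmod (by norm_num : Nat.Prime 7) hℓ7
  have he0 : e₀ ≠ 0 := by
    rintro rfl
    apply h7ne
    linear_combination he₀
  have hfac : (-(t : ZMod ℓ) - e₀ ^ 2) * (-(t : ZMod ℓ) + e₀ ^ 2 + 6) = 0 := by
    linear_combination hrt - he₀
  have hsq : IsSquare (-(t : ZMod ℓ)) ∧ IsSquare (-((6 - t : ℤ) : ZMod ℓ)) := by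
    rcases mul_eq_zero.1 hfac with h | h
    · have h1 : -(t : ZMod ℓ) = e₀ ^ 2 := by linear_combination h
      refine ⟨⟨e₀, by rw [h1]; ring⟩, ⟨c / e₀, ?_⟩⟩
      push_cast
      rw [div_mul_div_comm, eq_div_iff (mul_ne_zero he0 he0)]
      linear_combination (-1 : ZMod ℓ) * he₀ - e₀ ^ 2 * h1 + hc
    · have h1 : -(t : ZMod ℓ) = -e₀ ^ 2 - 6 := by linear_combination h
      refine ⟨⟨c / e₀, ?_⟩, ⟨e₀, by push_cast; linear_combination -h1⟩⟩
      rw [div_mul_div_comm, eq_div_iff (mul_ne_zero he0 he0)]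
      linear_combination (-1 : ZMod ℓ) * he₀ + e₀ ^ 2 * h1 + hc
  -- integral witnesses and classes for `θ` and `θ̄`
  obtain ⟨a₀, a₁, b₀, b₁, m₀, m₁, e, hX, hY, hposw, hNw⟩ :=
    (splitType_witness ℓ).1 u₀ v₀ g₀ g₁ t ℓ hℓ hℓ2 le_rfl hN ht hγ hpos hsq.1
  obtain ⟨a₀', a₁', b₀', b₁', m₀', m₁', e', hX', hY', hposw', hNw'⟩ :=
    (splitType_witness ℓ).1 (u₀ - 6 * v₀) (-v₀) (6 * g₁ - g₀) g₁ (6 - t) ℓ hℓ hℓ2 le_rfl hN' ht' hγ' hpos' hsq.2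
  have hC := class_of_witness hR u₀ v₀ h7u a₀ a₁ b₀ b₁ m₀ m₁ e hX hY hposw hNw
  have hC' := class_of_witness hR (u₀ - 6 * v₀) (-v₀) h7u' a₀' a₁' b₀' b₁' m₀' m₁' e' hX' hY' hposw' hNw'
  -- the two elements of `F` and their product `ℓ`
  set θ : realField R := AdjoinRoot.of (realPolyQ R) (u₀ : ℚ) + AdjoinRoot.of (realPolyQ R) (v₀ : ℚ) *
    AdjoinRoot.root (realPolyQ R) with hθ
  set θ' : realField R := AdjoinRoot.of (realPolyQ R) ((u₀ - 6 * v₀ : ℤ) : ℚ) +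
    AdjoinRoot.of (realPolyQ R) ((-v₀ : ℤ) : ℚ) * AdjoinRoot.root (realPolyQ R) with hθ'
  have hθ0 : θ ≠ 0 := of_pair_ne_zero hR (by rw [hN]; exact hℓ0.ne')
  have hθ'0 : θ' ≠ 0 := of_pair_ne_zero hR (by rw [hN']; exact hℓ0.ne')
  have hprod : θ * θ' = (ℓ : realField R) := by
    rw [hθ, hθ', of_pair_mul hR]
    have e1 : (u₀ : ℚ) * ((u₀ - 6 * v₀ : ℤ) : ℚ) - 7 * (v₀ : ℚ) * ((-v₀ : ℤ) : ℚ) = (ℓ : ℚ) := by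
      have h := congrArg (Int.cast : ℤ → ℚ) hN
      push_cast at h ⊢
      linear_combination h
    have e2 : (u₀ : ℚ) * ((-v₀ : ℤ) : ℚ) + (v₀ : ℚ) * ((u₀ - 6 * v₀ : ℤ) : ℚ) - 6 * (v₀ : ℚ) * ((-v₀ : ℤ) : ℚ) = 0 := by
      push_cast; ring
    rw [e1, e2, map_zero, zero_mul, add_zero, map_natCast]
  -- the characters at `(σ)`: `u₀ (u₀ - 6v₀) ≡ ℓ (mod 7)`
  have hχ : ((u₀ : ZMod 7)) * ((u₀ - 6 * v₀ : ℤ) : ZMod 7) = (ℓ : ZMod 7) := by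
    have := congrArg (Int.cast : ℤ → ZMod 7) hN
    push_cast at this ⊢
    linear_combination this - (v₀ : ZMod 7) ^ 2 * h70
  haveI : Fact (Nat.Prime 7) := ⟨by norm_num⟩
  have hu0 : (u₀ : ZMod 7) ≠ 0 := by rwa [Ne, ZMod.intCast_zmod_eq_zero_iff_dvd]
  have hu0' : ((u₀ - 6 * v₀ : ℤ) : ZMod 7) ≠ 0 := by rwa [Ne, ZMod.intCast_zmod_eq_zero_iff_dvd]
  -- units
  set U : (realField R)ˣ := Units.mk0 θ hθ0 with hU
  set U' : (realField R)ˣ := Units.mk0 θ' hθ'0 with hU'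
  have hU3 : ((Units.mk0 (3 : realField R) three_ne_zero) : realField R) = 3 := rfl
  constructor
  · intro hsqℓ w hw
    by_cases hsu : IsSquare ((u₀ : ZMod 7))
    · -- both characters trivial: `[θ] = [θ̄] = [1]`
      have hsu' : IsSquare (((u₀ - 6 * v₀ : ℤ) : ZMod 7)) := by
        obtain ⟨r, hr⟩ := hsu
        obtain ⟨s, hs⟩ := hsqℓ
        have hr0 : r ≠ 0 := by rintro rfl; exact hu0 (by rw [hr]; ring)
        refine ⟨s / r, ?_⟩
        rw [div_mul_div_comm, eq_div_iff (mul_ne_zero hr0 hr0)]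
        linear_combination hχ - (((u₀ - 6 * v₀ : ℤ) : ZMod 7)) * hr + hs
      have h1 := hC.1 hsu U (Units.val_mk0 _)
      have h2 := hC'.1 hsu' U' (Units.val_mk0 _)
      have hwU : w = U * U' := Units.ext (by rw [Units.val_mul, hU, hU', Units.val_mk0, Units.val_mk0, hprod, hw])
      rw [hwU]
      exact mk_mul_eq_splitDiscriminantClassCM_two _ _ h1 h2
    · -- both characters nontrivial: `[3θ] = [3θ̄] = [1]`, and `9ℓ = ℓ·3²`
      have hsu' : ¬ IsSquare (((u₀ - 6 * v₀ : ℤ) : ZMod 7)) := by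
        rintro ⟨r, hr⟩
        obtain ⟨s, hs⟩ := hsqℓ
        have hr0 : r ≠ 0 := by rintro rfl; exact hu0' (by rw [hr]; ring)
        refine hsu ⟨s / r, ?_⟩
        rw [div_mul_div_comm, eq_div_iff (mul_ne_zero hr0 hr0)]
        linear_combination hχ - (u₀ : ZMod 7) * hr + hs
      have h1 := hC.2 hsu (Units.mk0 3 three_ne_zero * U) (by rw [hU, Units.val_mul, Units.val_mk0, Units.val_mk0, hθ])
      have h2 := hC'.2 hsu' (Units.mk0 3 three_ne_zero * U') (by rw [hU', Units.val_mul, Units.val_mk0, Units.val_mk0, hθ'])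
      have hwU : (Units.mk0 3 three_ne_zero * U) * (Units.mk0 3 three_ne_zero * U')
          = w * (Units.mk0 (3 : realField R) three_ne_zero) ^ 2 :=
        Units.ext (by
          simp only [Units.val_mul, Units.val_pow_eq_pow_val, hU, hU', Units.val_mk0, hw, ← hprod]; ring)
      have := mk_mul_eq_splitDiscriminantClassCM_two _ _ h1 h2
      rwa [hwU, mk_mul_sq_cmNormResidueGroup] at this
  · intro hnsℓ w hw
    by_cases hsu : IsSquare ((u₀ : ZMod 7))
    · -- `[θ] = [1]`, `[3θ̄] = [1]`
      have hsu' : ¬ IsSquare (((u₀ - 6 * v₀ : ℤ) : ZMod 7)) := by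
        rintro ⟨r, hr⟩
        obtain ⟨s, hs⟩ := hsu
        exact hnsℓ ⟨s * r, by linear_combination -hχ + ((u₀ - 6 * v₀ : ℤ) : ZMod 7) * hs + s * s * hr⟩
      have h1 := hC.1 hsu U (Units.val_mk0 _)
      have h2 := hC'.2 hsu' (Units.mk0 3 three_ne_zero * U') (by rw [hU', Units.val_mul, Units.val_mk0, Units.val_mk0, hθ'])
      have hwU : w = U * (Units.mk0 3 three_ne_zero * U') :=
        Units.ext (by simp only [Units.val_mul, hU, hU', Units.val_mk0, hw, ← hprod]; ring)
      rw [hwU]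
      exact mk_mul_eq_splitDiscriminantClassCM_two _ _ h1 h2
    · -- `[3θ] = [1]`, `[θ̄] = [1]`
      have hsu' : IsSquare (((u₀ - 6 * v₀ : ℤ) : ZMod 7)) := by
        by_contra hns'
        obtain ⟨r, hr⟩ := isSquare_mul_of_not_isSquare hsu hns'
        exact hnsℓ ⟨r, by rw [← hr, hχ]⟩
      have h1 := hC.2 hsu (Units.mk0 3 three_ne_zero * U) (by rw [hU, Units.val_mul, Units.val_mk0, Units.val_mk0, hθ])
      have h2 := hC'.1 hsu' U' (Units.val_mk0 _)
      have hwU : w = (Units.mk0 3 three_ne_zero * U) * U' :=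
        Units.ext (by simp only [Units.val_mul, hU, hU', Units.val_mk0, hw, ← hprod]; ring)
      rw [hwU]
      exact mk_mul_eq_splitDiscriminantClassCM_two _ _ h1 h2

/-- **`[ℓ] = [1]` for EVERY prime `ℓ ≡ 1 (mod 8)` with `ℓ ≡ 1, 2, 4 (mod 7)` at which `T⁴ + 6T² + 7` has a root**
(the third split type of part O; rows `[137] = [193] = [401] = … = [1]` with `ℓ` variable).
[cite: Deligne1982HodgeCycles, §4 p. 30 (1) and Cor. 4.2] [cite: Landherr1936HermitianForms] -/
theorem sqrtNegThreePlusSqrtTwo_mk_prime_eq_splitDiscriminantClassCM_of_mod_eight_one (ℓ : ℕ) (hℓ : ℓ.Prime)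
    (h8 : ℓ % 8 = 1) (h7 : ℓ % 7 = 1 ∨ ℓ % 7 = 2 ∨ ℓ % 7 = 4) (hroot : ∃ e₀ : ZMod ℓ, e₀ ^ 4 + 6 * e₀ ^ 2 + 7 = 0)
    (u : (realField R)ˣ) (hu : (u : realField R) = ℓ) :
    (QuotientGroup.mk u : cmNormResidueGroup R) = splitDiscriminantClassCM R 2 := by
  have hsq7 : IsSquare ((ℓ : ZMod 7)) := by
    rw [← ZMod.natCast_mod ℓ 7]
    rcases h7 with h | h | h <;> rw [h] <;> decide
  haveI : Fact ℓ.Prime := ⟨hℓ⟩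
  have hℓ2 : ℓ ≠ 2 := by omega
  have hℓ7 : ℓ ≠ 7 := by omega
  have h2 : IsSquare (2 : ZMod ℓ) := by rw [ZMod.exists_sq_eq_two_iff hℓ2]; omega
  have h7sq : IsSquare (7 : ZMod ℓ) := by
    haveI : Fact (Nat.Prime 7) := ⟨by norm_num⟩
    have := (ZMod.exists_sq_eq_prime_iff_of_mod_four_eq_one (p := ℓ) (q := 7) (by omega) (by norm_num)).2
      (by exact_mod_cast hsq7)
    exact_mod_cast this
  exact (sqrtNegThreePlusSqrtTwo_class_split_prime hR ℓ hℓ hℓ2 hℓ7 h2 h7sq hroot).1 hsq7 u hu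

/-- **`[3ℓ] = [1]` for every prime `ℓ ≡ 7 (mod 8)` with `ℓ ≡ 3, 5, 6 (mod 7)` at which `T⁴ + 6T² + 7` has a root**
(`(7/ℓ) = -(ℓ/7) = +1`, both places split in `E`, `ℓ` a non-square at `(σ)`: `[ℓ] = [3]`; rows `[31] = [47] = …`).
[cite: Deligne1982HodgeCycles, §4 p. 30 (1) and Cor. 4.2] [cite: Landherr1936HermitianForms] -/
theorem sqrtNegThreePlusSqrtTwo_mk_three_mul_prime_eq_splitDiscriminantClassCM_of_mod_eight_seven (ℓ : ℕ)
    (hℓ : ℓ.Prime) (h8 : ℓ % 8 = 7) (h7 : ℓ % 7 = 3 ∨ ℓ % 7 = 5 ∨ ℓ % 7 = 6)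
    (hroot : ∃ e₀ : ZMod ℓ, e₀ ^ 4 + 6 * e₀ ^ 2 + 7 = 0)
    (u : (realField R)ˣ) (hu : (u : realField R) = 3 * ℓ) :
    (QuotientGroup.mk u : cmNormResidueGroup R) = splitDiscriminantClassCM R 2 := by
  have hns7 : ¬ IsSquare ((ℓ : ZMod 7)) := by
    rw [← ZMod.natCast_mod ℓ 7]
    rcases h7 with h | h | h <;> rw [h] <;> decide
  haveI : Fact ℓ.Prime := ⟨hℓ⟩
  have hℓ2 : ℓ ≠ 2 := by omega
  have hℓ7 : ℓ ≠ 7 := by omega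
  have h2 : IsSquare (2 : ZMod ℓ) := by rw [ZMod.exists_sq_eq_two_iff hℓ2]; omega
  have h7sq : IsSquare (7 : ZMod ℓ) := by
    haveI : Fact (Nat.Prime 7) := ⟨by norm_num⟩
    by_contra h
    have key := ZMod.exists_sq_eq_prime_iff_of_mod_four_eq_three (p := ℓ) (q := 7) (by omega) (by norm_num) hℓ7
    have : IsSquare ((ℓ : ℕ) : ZMod 7) := by
      by_contra h'
      exact h (by exact_mod_cast key.2 h')
    exact hns7 this
  exact (sqrtNegThreePlusSqrtTwo_class_split_prime hR ℓ hℓ hℓ2 hℓ7 h2 h7sq hroot).2 hns7 u hu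

/-! ### §3 The complete classification of `[ℓ]`, every prime -/

/-- **The prime classification of the seventh census table (`E = ℚ(√-(3+√2))`, non-Galois, `h(E) = 2`), every
prime `ℓ`: `[ℓ] = [1]` in `F^×/Nm_{E/F}(E^×)` iff `ℓ = 2`, or `ℓ ≡ 5 (mod 8)` and `ℓ ≡ 1, 2, 4 (mod 7)`, or
`ℓ ≡ 1 (mod 8)`, `ℓ ≡ 1, 2, 4 (mod 7)` and `T⁴ + 6T² + 7` has a root mod `ℓ`** (necessity: part O; sufficiency:
§1, §2 and `2 = (3+σ)²`). With parts A–N every one of the seven census fields now has the split/non-split type of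
the component `W8.E.[ℓ]` decided for every rational prime. [cite: Deligne1982HodgeCycles, §4 p. 30 (1) and Cor. 4.2]
[cite: Landherr1936HermitianForms] -/
theorem sqrtNegThreePlusSqrtTwo_mk_prime_eq_splitDiscriminantClassCM_iff (ℓ : ℕ) (hℓ : ℓ.Prime)
    (u : (realField R)ˣ) (hu : (u : realField R) = ℓ) :
    (QuotientGroup.mk u : cmNormResidueGroup R) = splitDiscriminantClassCM R 2 ↔
      (ℓ = 2 ∨ (ℓ % 8 = 5 ∧ (ℓ % 7 = 1 ∨ ℓ % 7 = 2 ∨ ℓ % 7 = 4)) ∨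
        (ℓ % 8 = 1 ∧ (ℓ % 7 = 1 ∨ ℓ % 7 = 2 ∨ ℓ % 7 = 4) ∧ ∃ e : ZMod ℓ, e ^ 4 + 6 * e ^ 2 + 7 = 0)) := by
  refine ⟨sqrtNegThreePlusSqrtTwo_splitType_of_mk_prime_eq_splitDiscriminantClassCM hR ℓ hℓ u hu, ?_⟩
  rintro (h2 | ⟨h8, h7⟩ | ⟨h8, h7, hroot⟩)
  · subst h2
    exact mk_eq_splitDiscriminantClassCM_two_of_coords_of_pos hR (by norm_num) (by norm_num) disc_not_sq_six_seven
      2 3 1 0 0 1 one_ne_zero (by norm_num) (by norm_num) u (by rw [hu]; norm_num)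
  · exact sqrtNegThreePlusSqrtTwo_mk_prime_eq_splitDiscriminantClassCM_of_mod_eight_five hR ℓ hℓ h8 h7 u hu
  · exact sqrtNegThreePlusSqrtTwo_mk_prime_eq_splitDiscriminantClassCM_of_mod_eight_one hR ℓ hℓ h8 h7 hroot u hu

/-- **`[ℓ] ≠ [1]` iff `ℓ` is NOT of split type** — contrapositive packaging for the census's non-split column.
[cite: Deligne1982HodgeCycles, §4 p. 30 (1) and Cor. 4.2] -/
theorem sqrtNegThreePlusSqrtTwo_mk_prime_ne_splitDiscriminantClassCM_iff' (ℓ : ℕ) (hℓ : ℓ.Prime)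
    (u : (realField R)ˣ) (hu : (u : realField R) = ℓ) :
    (QuotientGroup.mk u : cmNormResidueGroup R) ≠ splitDiscriminantClassCM R 2 ↔
      ¬ (ℓ = 2 ∨ (ℓ % 8 = 5 ∧ (ℓ % 7 = 1 ∨ ℓ % 7 = 2 ∨ ℓ % 7 = 4)) ∨
        (ℓ % 8 = 1 ∧ (ℓ % 7 = 1 ∨ ℓ % 7 = 2 ∨ ℓ % 7 = 4) ∧ ∃ e : ZMod ℓ, e ^ 4 + 6 * e ^ 2 + 7 = 0)) :=
  (sqrtNegThreePlusSqrtTwo_mk_prime_eq_splitDiscriminantClassCM_iff hR ℓ hℓ u hu).not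

end SqrtNegThreePlusSqrtTwo

/-! ### Literal packaging (`R = S² + 6S + 7` verbatim) -/

/-- **The complete prime classification of the seventh census table, unconditionally** (`R = S² + 6S + 7`
literally, the field `Fact` discharged): for every prime `ℓ` and every unit `u = ℓ` of `F = ℚ[S]/(S² + 6S + 7)`,
`[u] = [1]` in `F^×/Nm_{E/F}(E^×)` iff `ℓ = 2 ∨ (ℓ ≡ 5 (8) ∧ ℓ ≡ 1,2,4 (7)) ∨ (ℓ ≡ 1 (8) ∧ ℓ ≡ 1,2,4 (7) ∧
∃ e, e⁴ + 6e² + 7 ≡ 0 (mod ℓ))`. [cite: Deligne1982HodgeCycles, §4 p. 30 (1) and Cor. 4.2]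
[cite: Landherr1936HermitianForms] -/
theorem sqrtNegThreePlusSqrtTwo_prime_classification :
    haveI := fact_irreducible_realPolyQ_of_not_sq (R := X ^ 2 + C 6 * X + C 7) rfl disc_not_sq_six_seven
    ∀ ℓ : ℕ, ℓ.Prime → ∀ u : (realField (X ^ 2 + C 6 * X + C 7))ˣ, (u : realField (X ^ 2 + C 6 * X + C 7)) = ℓ →
      ((QuotientGroup.mk u : cmNormResidueGroup (X ^ 2 + C 6 * X + C 7)) =
          splitDiscriminantClassCM (X ^ 2 + C 6 * X + C 7) 2 ↔
        (ℓ = 2 ∨ (ℓ % 8 = 5 ∧ (ℓ % 7 = 1 ∨ ℓ % 7 = 2 ∨ ℓ % 7 = 4)) ∨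
          (ℓ % 8 = 1 ∧ (ℓ % 7 = 1 ∨ ℓ % 7 = 2 ∨ ℓ % 7 = 4) ∧ ∃ e : ZMod ℓ, e ^ 4 + 6 * e ^ 2 + 7 = 0))) := by
  haveI := fact_irreducible_realPolyQ_of_not_sq (R := X ^ 2 + C 6 * X + C 7) rfl disc_not_sq_six_seven
  exact fun ℓ hℓ u hu => sqrtNegThreePlusSqrtTwo_mk_prime_eq_splitDiscriminantClassCM_iff rfl ℓ hℓ u hu

end Summit.HodgeConjecture.HodgeConjecture.Ring2.WeilCoverageCM

end
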